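import Mathlib
import Literature.MathematicalPhysics.StatisticalMechanics.BarlowStacking
import Literature.Geometry.DiscreteGeometry.TwoShellPatterns
import Summits.AtomisticToContinuum.Crystallization.Theorems.PhononSlackCertificatesNearFieldConvexityStubPnfOfLocalCertificate8
import Summits.AtomisticToContinuum.Crystallization.Theorems.PhononSlackCertificatesNearFieldConvexityStubPairCountOfCrossing
import Summits.AtomisticToContinuum.Crystallization.Theorems.PhononSlackCertificatesNearFieldConvexityStubSelfSiteFloor
import Summits.AtomisticToContinuum.Crystallization.Theorems.PhononSlackCertificatesNearFieldConvexityStubFluxEnvelope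
import Summits.AtomisticToContinuum.Crystallization.Theorems.BraggSlacknessRigidityStrictCertificateFlatness

/-!
# Route `NashClassCertificates`, crux `NashNearField` (stmt-AtomisticToContinuum-16827), line `birth`:
# pieces for the stub `stub_smoothRegimeCoercivity` (B″, the summed Cauchy–Born coercivity in the smooth regime)

B″ asks, for all `1/3`-separated configurations, all sets `Ω` of 1/20-good particles and all assignments of
Hägg words and affine flatness witnesses `(s_i, G_i, ν_i)` at the radius-8 interior sites of `Ω` with `ν_i ≤ ν₁`,
that the interior sites whose affine part `G_i` is `r`-far from the box-scaled isometric templates of their own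
word are paid quadratically: `κ r²·#{far interior sites} ≤ [E(x|_Ω) − |Ω| e*] + C_R Σ_{int₈Ω} ν_i² + C·#∂₄Ω`.
Its analytic content (sitewise Cauchy–Born expansion with explicit Lennard-Jones remainders, exact cancellation
of the first-order terms, and the certified Cauchy–Born landscape of strained Barlow stackings) is research-sized;
this file lands the two provable interfaces around it.

* `lsc_bookkeeping` — abstract weighted bookkeeping on a finite index type: a pointwise calibrated bound
  `g i ≤ E i + Σ_{j∈Ω} τ i j` on an interior `I ⊆ Ω` with an antisymmetric transfer `τ`, a flux bound into the
  collar `B = Ω ∖ I` and a floor `−L ≤ E` on the collar give `Σ_I g − L·#B − Φ ≤ Σ_Ω E`.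
* `stub_bsmoothOfLocalSmoothCertificate` — **B″ from its pointwise calibrated form** (the LOCAL SMOOTH
  CERTIFICATE): if, for the same data as B″, there is an antisymmetric transfer `τ` dominated by
  `M·r⁻⁶` such that at every radius-8 interior site `−C_R ν_i² ≤ (e_i^Ω − e*) + Σ_j τ i j`, and
  `κ r² − C_R ν_i² ≤ (e_i^Ω − e*) + Σ_j τ i j` at the far sites, then B″ holds verbatim, with the same `κ, ν₁, C_R`
  and `C = ((250/12)·3⁶ + 250·|M|·3⁶)·(1 + |C_p|(17/4)⁴)`: internal transfers cancel, the flux into the radius-8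
  collar is bounded by the landed flux envelope (`stub_fluxEnvelope`), collar sites by the landed self-site floor
  (`stub_selfSiteFloor`), and the collar by the landed collar and pair counts (`collar8_card_le`,
  `stub_pairCountOfCrossing`).  This is the twin crux's `stub_pnfOfLocalCertificate8` with a weighted right-hand
  side; by Hoffman's circulation theorem the pointwise-with-transfers form loses nothing against the summed form.
* `stub_famFarOpNorm` — the interface between the far-from-family count and the landscape numerics: if a
  continuous linear map `T` realises the box-scaled isometric template `A (barlowPos a h s ·)` on the unit
  template sites, then an `r`-far witness of norm `≤ 3` forces `r ≤ 3 ‖G − T‖`; and such a `T` always exists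
  (`exists_clm_boxTemplate`, `stub_boxTemplateRealizer`: `T = A ∘ (a·id + (h/h₀ − a)·e₃ ⊗ e₃*)`, `h₀ = √6/3`).
* `stub_ljPairTaylor` — the remainder of the sitewise Cauchy–Born expansion, one bond at a time: for `v ≠ 0` and
  `‖u‖ ≤ ‖v‖/4`, `|V(‖v+u‖) − V(‖v‖) − (−‖v‖⁻¹⁴ + ‖v‖⁻⁸)⟪v,u⟫| ≤ ‖u‖² (7281 ‖v‖⁻¹⁴ + 521 ‖v‖⁻⁸)`
  (`V′(r)/r = −r⁻¹⁴ + r⁻⁸`; the one-sided companion of the tree's `lennardJones_secondDiff_le`, through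
  `V(r) = Ṽ(r²)` and the landed second-order Taylor bound `abs_tildeV_taylor_le` for `Ṽ`).
-/

noncomputable section

open scoped BigOperators RealInnerProductSpace
open Literature.MathematicalPhysics.StatisticalMechanics Literature.Geometry.DiscreteGeometry

namespace Summit.AtomisticToContinuum.Crystallization.Theorems.NashClassCertificatesNashNearField

open Summit.AtomisticToContinuum.Crystallization.Theorems.PhononSlackNearFieldConvexity

/-- **Abstract weighted bookkeeping for a local certificate.**  On a finite index type: a region `Ω`, an
interior `I ⊆ Ω`, the collar `B = Ω ∖ I`; an antisymmetric transfer `τ`, site excesses `E` and demands `g`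
with the calibrated pointwise bound `g i ≤ E i + Σ_{j∈Ω} τ i j` on `I`, a bound `Φ` on the flux
`Σ_{i∈I} Σ_{j∈B} τ i j` into the collar, and the floor `−L ≤ E` on the collar; then
`Σ_I g − L·#B − Φ ≤ Σ_Ω E` (internal transfers cancel by antisymmetry). [folklore] -/
theorem lsc_bookkeeping {ι : Type*} (g E : ι → ℝ) (τ : ι → ι → ℝ) (Ω I B : Finset ι) {Φ L : ℝ}
    (hτ : ∀ i j, τ i j = -τ j i) (hI : I ⊆ Ω) (hB : ∀ i, i ∈ B ↔ i ∈ Ω ∧ i ∉ I)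
    (hpt : ∀ i ∈ I, g i ≤ E i + ∑ j ∈ Ω, τ i j)
    (hflux : ∑ i ∈ I, ∑ j ∈ B, τ i j ≤ Φ) (hbdry : ∀ i ∈ B, -L ≤ E i) :
    (∑ i ∈ I, g i) - L * (B.card : ℝ) - Φ ≤ ∑ i ∈ Ω, E i := by
  classical
  -- split the region into interior and collar
  have hΩsplit : ∀ f : ι → ℝ, ∑ i ∈ Ω, f i = ∑ i ∈ I, f i + ∑ i ∈ B, f i := by
    intro f
    rw [← Finset.sum_filter_add_sum_filter_not Ω (fun i => i ∈ I)]
    congr 1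
    · congr 1
      ext i
      simp only [Finset.mem_filter]
      exact ⟨fun h => h.2, fun h => ⟨hI h, h⟩⟩
    · congr 1
      ext i
      rw [Finset.mem_filter, hB]
  -- interior: the calibrated pointwise bound, summed
  have hint : ∑ i ∈ I, g i ≤ ∑ i ∈ I, (E i + ∑ j ∈ Ω, τ i j) := Finset.sum_le_sum hpt
  -- internal transfers cancel
  have hanti : ∑ i ∈ I, ∑ j ∈ I, τ i j = 0 := by
    have h := Finset.sum_comm (s := I) (t := I) (f := τ)
    have h2 : ∑ j ∈ I, ∑ i ∈ I, τ i j = -∑ j ∈ I, ∑ i ∈ I, τ j i := by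
      rw [← Finset.sum_neg_distrib]
      refine Finset.sum_congr rfl fun j _ => ?_
      rw [← Finset.sum_neg_distrib]
      exact Finset.sum_congr rfl fun i _ => hτ i j
    linarith
  -- the transfer sum over `Ω` splits into the internal part and the flux into the collar
  have hτsplit : ∑ i ∈ I, ∑ j ∈ Ω, τ i j = ∑ i ∈ I, ∑ j ∈ I, τ i j + ∑ i ∈ I, ∑ j ∈ B, τ i j := by
    rw [← Finset.sum_add_distrib]
    exact Finset.sum_congr rfl fun i _ => hΩsplit (τ i)
  have hIsum : ∑ i ∈ I, g i - Φ ≤ ∑ i ∈ I, E i := by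
    have h1 : ∑ i ∈ I, (E i + ∑ j ∈ Ω, τ i j) = ∑ i ∈ I, E i + ∑ i ∈ I, ∑ j ∈ Ω, τ i j :=
      Finset.sum_add_distrib
    rw [h1, hτsplit, hanti, zero_add] at hint
    linarith
  -- collar: the floor
  have hBsum : -L * (B.card : ℝ) ≤ ∑ i ∈ B, E i := by
    have h : ∑ _i ∈ B, (-L) ≤ ∑ i ∈ B, E i := Finset.sum_le_sum fun i hi => hbdry i hi
    rwa [Finset.sum_const, nsmul_eq_mul, mul_comm] at h
  rw [hΩsplit E]
  linarith

/-- **Stub piece `stub_bsmoothOfLocalSmoothCertificate`: B″ from the LOCAL SMOOTH CERTIFICATE (bookkeeping,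
proved).**  Suppose that for the data of B″ — threshold `r ∈ (0, 1/10]`, a `1/3`-separated configuration, a set
`Ω` of 1/20-good particles, words and flatness witnesses `(s_i, G_i, ν_i)` with `ν_i ≤ ν₁` at the radius-8
interior sites — there is an antisymmetric transfer `τ` with `|τ i j| ≤ M·|x i − x j|⁻⁶` such that at every
radius-8 interior site `i` the calibrated partial site excess `(½Σ_{j∈Ω∖i} V − e*) + Σ_{j∈Ω} τ i j` is at least
`−C_R ν_i²`, and at least `κ r² − C_R ν_i²` when `G_i` is `r`-far from the family (`FamFar_r(i)`).  Then B″ holds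
verbatim with the same `κ, ν₁, C_R` and `C = ((250/12)·3⁶ + 250·|M|·3⁶)·(1 + |C_p|·(17/4)⁴)`, `C_p` the constant
of the landed pair count `stub_pairCountOfCrossing` at `δ = 1/3`: sum the pointwise bounds over the radius-8
interior (`lsc_bookkeeping`), cancel internal transfers, bound the flux into the radius-8 collar by the landed
flux envelope, floor the collar sites by the landed self-site floor, and count the collar by `collar8_card_le`
and the pair count at scale `17/4`. [folklore] -/
theorem stub_bsmoothOfLocalSmoothCertificate :
    (∃ κ : ℝ, 0 < κ ∧ ∃ ν₁ : ℝ, 0 < ν₁ ∧ ∃ CR M : ℝ, ∀ r : ℝ, 0 < r → r ≤ 1 / 10 →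
      ∀ (N : ℕ) (x : Fin N → EuclideanSpace ℝ (Fin 3)), (∀ i j : Fin N, i ≠ j → 1 / 3 ≤ dist (x i) (x j)) →
      ∀ Ω : Finset (Fin N), (∀ i ∈ Ω, IsTwoShellGood (1 / 20) (47 / 50) 1 x i) →
      ∀ (sW : Fin N → ℤ → ℤ) (Gw : Fin N → (EuclideanSpace ℝ (Fin 3) →L[ℝ] EuclideanSpace ℝ (Fin 3))) (νw : Fin N → ℝ),
      (∀ i ∈ Ω, (∀ k : Fin N, dist (x k) (x i) ≤ 8 → k ∈ Ω) → IsHaggSeq (sW i) ∧ 0 ≤ νw i ∧ νw i ≤ ν₁ ∧ ((∀ j : Fin N, dist (x j) (x i) ≤ 3 → ∃ m u v : ℤ, dist (x j - x i) ((Gw i) (barlowPos 1 (Real.sqrt 6 / 3) (sW i) m u v)) ≤ (νw i)) ∧ (∀ m u v : ℤ, ‖(Gw i) (barlowPos 1 (Real.sqrt 6 / 3) (sW i) m u v)‖ ≤ 3 → ∃ j : Fin N, dist (x j - x i) ((Gw i) (barlowPos 1 (Real.sqrt 6 / 3) (sW i) m u v)) ≤ (νw i)) ∧ (∀ p : EuclideanSpace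 ℝ (Fin 3), 4 / 5 * ‖p‖ ≤ ‖(Gw i) p‖ ∧ ‖(Gw i) p‖ ≤ 6 / 5 * ‖p‖))) →
        ∃ τ : Fin N → Fin N → ℝ, (∀ i j : Fin N, τ i j = -τ j i) ∧
          (∀ i j : Fin N, |τ i j| ≤ M * (dist (x i) (x j))⁻¹ ^ 6) ∧
          ∀ i ∈ Ω, (∀ k : Fin N, dist (x k) (x i) ≤ 8 → k ∈ Ω) →
            (-(CR * (νw i) ^ 2) ≤ ((1 / 2 : ℝ) * (∑ j ∈ Ω.erase i, lennardJones (dist (x i) (x j))) - (⨅ Q : PeriodicConfiguration 3, Q.energyPerParticle lennardJones)) + ∑ j ∈ Ω, τ i j) ∧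
            ((∀ (A : EuclideanSpace ℝ (Fin 3) →ₗᵢ[ℝ] EuclideanSpace ℝ (Fin 3)) (a h : ℝ), 47 / 50 ≤ a → a ≤ 1 → 39 / 50 * a ≤ h → h ≤ 17 / 20 * a → ∃ m u v : ℤ, ‖barlowPos 1 (Real.sqrt 6 / 3) (sW i) m u v‖ ≤ 3 ∧ r ≤ dist ((Gw i) (barlowPos 1 (Real.sqrt 6 / 3) (sW i) m u v)) (A (barlowPos a h (sW i) m u v))) →
              κ * r ^ 2 - CR * (νw i) ^ 2 ≤ ((1 / 2 : ℝ) * (∑ j ∈ Ω.erase i, lennardJones (dist (x i) (x j))) - (⨅ Q : PeriodicConfiguration 3, Q.energyPerParticle lennardJones)) + ∑ j ∈ Ω, τ i j)) →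
    ∃ κ : ℝ, 0 < κ ∧ ∃ ν₁ : ℝ, 0 < ν₁ ∧ ∃ CR C : ℝ, ∀ r : ℝ, 0 < r → r ≤ 1 / 10 →
      ∀ (N : ℕ) (x : Fin N → EuclideanSpace ℝ (Fin 3)), (∀ i j : Fin N, i ≠ j → 1 / 3 ≤ dist (x i) (x j)) →
      ∀ Ω : Finset (Fin N), (∀ i ∈ Ω, IsTwoShellGood (1 / 20) (47 / 50) 1 x i) →
      ∀ (sW : Fin N → ℤ → ℤ) (Gw : Fin N → (EuclideanSpace ℝ (Fin 3) →L[ℝ] EuclideanSpace ℝ (Fin 3))) (νw : Fin N → ℝ),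
      (∀ i ∈ Ω, (∀ k : Fin N, dist (x k) (x i) ≤ 8 → k ∈ Ω) → IsHaggSeq (sW i) ∧ 0 ≤ νw i ∧ νw i ≤ ν₁ ∧ ((∀ j : Fin N, dist (x j) (x i) ≤ 3 → ∃ m u v : ℤ, dist (x j - x i) ((Gw i) (barlowPos 1 (Real.sqrt 6 / 3) (sW i) m u v)) ≤ (νw i)) ∧ (∀ m u v : ℤ, ‖(Gw i) (barlowPos 1 (Real.sqrt 6 / 3) (sW i) m u v)‖ ≤ 3 → ∃ j : Fin N, dist (x j - x i) ((Gw i) (barlowPos 1 (Real.sqrt 6 / 3) (sW i) m u v)) ≤ (νw i)) ∧ (∀ p : EuclideanSpace ℝ (Fin 3), 4 / 5 * ‖p‖ ≤ ‖(Gw i) p‖ ∧ ‖(Gw i) p‖ ≤ 6 / 5 * ‖p‖))) →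
        κ * r ^ 2 * (Nat.card {i : Fin N // i ∈ Ω ∧ ((∀ k : Fin N, dist (x k) (x i) ≤ 8 → k ∈ Ω) ∧ (∀ (A : EuclideanSpace ℝ (Fin 3) →ₗᵢ[ℝ] EuclideanSpace ℝ (Fin 3)) (a h : ℝ), 47 / 50 ≤ a → a ≤ 1 → 39 / 50 * a ≤ h → h ≤ 17 / 20 * a → ∃ m u v : ℤ, ‖barlowPos 1 (Real.sqrt 6 / 3) (sW i) m u v‖ ≤ 3 ∧ r ≤ dist ((Gw i) (barlowPos 1 (Real.sqrt 6 / 3) (sW i) m u v)) (A (barlowPos a h (sW i) m u v))))} : ℝ) ≤ (∑ i ∈ Ω, (1 / 2 : ℝ) * (∑ j ∈ Ω.erase i, lennardJones (dist (x i) (x j)))) - (Ω.card : ℝ) * (⨅ Q : PeriodicConfiguration 3, Q.energyPerParticle lennardJones) + CR * (∑ i ∈ Ω.filter (fun i => (∀ k : Fin N, dist (x k) (x i) ≤ 8 → k ∈ Ω)), (νw i) ^ 2) + C * (Nat.card {i : Fin N // i ∈ Ω ∧ ∃ j : Fin N, j ∉ Ω ∧ dist (x j) (x i) ≤ 4} :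 ℝ) := by
  intro hLSC
  obtain ⟨κ, hκ, ν₁, hν₁, CR, M, hcert⟩ := hLSC
  have hδ : (0 : ℝ) < 1 / 3 := by norm_num
  obtain ⟨Cp, hCp⟩ := stub_pairCountOfCrossing (1 / 3) hδ
  set K : ℝ := 1 + |Cp| * (17 / 4 : ℝ) ^ 4 with hKdef
  set L : ℝ := 250 / 12 * (1 / 3 : ℝ)⁻¹ ^ 6 with hLdef
  set Φc : ℝ := 250 * |M| * (1 / 3 : ℝ)⁻¹ ^ 6 with hΦcdef
  refine ⟨κ, hκ, ν₁, hν₁, CR, (L + Φc) * K, ?_⟩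
  intro r hr hr10 N x hsep Ω hΩ sW Gw νw hW
  obtain ⟨τ, hτ, hτM, hpt⟩ := hcert r hr hr10 N x hsep Ω hΩ sW Gw νw hW
  -- radius-8 interior and collar of `Ω` (elaborated before `classical`, as in the statement)
  set I : Finset (Fin N) := Ω.filter (fun i => ∀ k : Fin N, dist (x k) (x i) ≤ 8 → k ∈ Ω) with hIdef
  set B : Finset (Fin N) := Ω.filter (fun i => ∃ j : Fin N, j ∉ Ω ∧ dist (x j) (x i) ≤ 8) with hBdef
  classical
  rw [lc_natCard_eq, lc_natCard_eq]
  have hIΩ : I ⊆ Ω := Finset.filter_subset _ _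
  have hImem : ∀ i, i ∈ I ↔ i ∈ Ω ∧ (∀ k : Fin N, dist (x k) (x i) ≤ 8 → k ∈ Ω) := fun i => by
    rw [hIdef, Finset.mem_filter]
  have hBmem : ∀ i, i ∈ B ↔ i ∈ Ω ∧ i ∉ I := by
    intro i
    rw [hImem]
    simp only [hBdef, Finset.mem_filter]
    constructor
    · rintro ⟨hi, j, hj, hd⟩
      exact ⟨hi, fun h' => hj (h'.2 j hd)⟩
    · rintro ⟨hi, h'⟩
      refine ⟨hi, ?_⟩
      by_contra hne
      exact h' ⟨hi, fun j hd => by_contra fun hj => hne ⟨j, hj, hd⟩⟩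
  have hdisj : Disjoint I B := by
    rw [Finset.disjoint_left]
    intro i hiI hiB
    exact ((hBmem i).1 hiB).2 hiI
  -- the flux into the collar, by the envelope
  have hfluxIB : ∑ i ∈ I, ∑ j ∈ B, τ i j ≤ Φc * (B.card : ℝ) := by
    have h1 : ∑ i ∈ I, ∑ j ∈ B, τ i j ≤ ∑ i ∈ I, ∑ j ∈ B, |M| * (dist (x i) (x j))⁻¹ ^ 6 := by
      refine Finset.sum_le_sum fun i _ => Finset.sum_le_sum fun j _ => ?_
      have hb := hτM i j
      have h0 : (0 : ℝ) ≤ (dist (x i) (x j))⁻¹ ^ 6 := by positivity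
      calc τ i j ≤ |τ i j| := le_abs_self _
        _ ≤ M * (dist (x i) (x j))⁻¹ ^ 6 := hb
        _ ≤ |M| * (dist (x i) (x j))⁻¹ ^ 6 := mul_le_mul_of_nonneg_right (le_abs_self M) h0
    have h2 : ∑ i ∈ I, ∑ j ∈ B, |M| * (dist (x i) (x j))⁻¹ ^ 6 =
        |M| * ∑ i ∈ I, ∑ j ∈ B, (dist (x i) (x j))⁻¹ ^ 6 := by
      rw [Finset.mul_sum]
      refine Finset.sum_congr rfl fun i _ => ?_
      rw [Finset.mul_sum]
    have h3 := stub_fluxEnvelope N x (1 / 3) hδ hsep I B hdisj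
    have hM0 : 0 ≤ |M| := abs_nonneg M
    rw [h2] at h1
    have h4 : |M| * ∑ i ∈ I, ∑ j ∈ B, (dist (x i) (x j))⁻¹ ^ 6 ≤ |M| * (250 * (1 / 3 : ℝ)⁻¹ ^ 6 * (B.card : ℝ)) :=
      mul_le_mul_of_nonneg_left h3 hM0
    rw [hΦcdef]
    linarith
  -- the demands and the site excesses
  have hptg : ∀ i ∈ I,
      (fun i => (if (∀ (A : EuclideanSpace ℝ (Fin 3) →ₗᵢ[ℝ] EuclideanSpace ℝ (Fin 3)) (a h : ℝ), 47 / 50 ≤ a → a ≤ 1 → 39 / 50 * a ≤ h → h ≤ 17 / 20 * a → ∃ m u v : ℤ, ‖barlowPos 1 (Real.sqrt 6 / 3) (sW i) m u v‖ ≤ 3 ∧ r ≤ dist ((Gw i) (barlowPos 1 (Real.sqrt 6 / 3) (sW i) m u v)) (A (barlowPos a h (sW i) m u v))) then κ * r ^ 2 else 0) - CR * (νw i) ^ 2) i ≤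
        (fun i => ((1 / 2 : ℝ) * (∑ j ∈ Ω.erase i, lennardJones (dist (x i) (x j))) - (⨅ Q : PeriodicConfiguration 3, Q.energyPerParticle lennardJones))) i + ∑ j ∈ Ω, τ i j := by
    intro i hi
    obtain ⟨hiΩ, h8⟩ := (hImem i).1 hi
    obtain ⟨h0, h1⟩ := hpt i hiΩ h8
    simp only
    split_ifs with hF
    · exact h1 hF
    · linarith
  -- the abstract bookkeeping
  have key := lsc_bookkeeping
    (fun i => (if (∀ (A : EuclideanSpace ℝ (Fin 3) →ₗᵢ[ℝ] EuclideanSpace ℝ (Fin 3)) (a h : ℝ), 47 / 50 ≤ a → a ≤ 1 → 39 / 50 * a ≤ h → h ≤ 17 / 20 * a → ∃ m u v : ℤ, ‖barlowPos 1 (Real.sqrt 6 / 3) (sW i) m u v‖ ≤ 3 ∧ r ≤ dist ((Gw i) (barlowPos 1 (Real.sqrt 6 / 3) (sW i) m u v)) (A (barlowPos a h (sW i) m u v))) then κ * r ^ 2 else 0) - CR * (νw i) ^ 2)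
    (fun i => ((1 / 2 : ℝ) * (∑ j ∈ Ω.erase i, lennardJones (dist (x i) (x j))) - (⨅ Q : PeriodicConfiguration 3, Q.energyPerParticle lennardJones)))
    τ Ω I B hτ hIΩ hBmem hptg hfluxIB (fun i _ => stub_selfSiteFloor N x (1 / 3) hδ hsep Ω i)
  -- evaluate the demand sum
  have hgsum : ∑ i ∈ I, ((if (∀ (A : EuclideanSpace ℝ (Fin 3) →ₗᵢ[ℝ] EuclideanSpace ℝ (Fin 3)) (a h : ℝ), 47 / 50 ≤ a → a ≤ 1 → 39 / 50 * a ≤ h → h ≤ 17 / 20 * a → ∃ m u v : ℤ, ‖barlowPos 1 (Real.sqrt 6 / 3) (sW i) m u v‖ ≤ 3 ∧ r ≤ dist ((Gw i) (barlowPos 1 (Real.sqrt 6 / 3) (sW i) m u v)) (A (barlowPos a h (sW i) m u v))) then κ * r ^ 2 else 0) - CR * (νw i) ^ 2) =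
      κ * r ^ 2 * ((I.filter (fun i => (∀ (A : EuclideanSpace ℝ (Fin 3) →ₗᵢ[ℝ] EuclideanSpace ℝ (Fin 3)) (a h : ℝ), 47 / 50 ≤ a → a ≤ 1 → 39 / 50 * a ≤ h → h ≤ 17 / 20 * a → ∃ m u v : ℤ, ‖barlowPos 1 (Real.sqrt 6 / 3) (sW i) m u v‖ ≤ 3 ∧ r ≤ dist ((Gw i) (barlowPos 1 (Real.sqrt 6 / 3) (sW i) m u v)) (A (barlowPos a h (sW i) m u v))))).card : ℝ) - CR * ∑ i ∈ I, (νw i) ^ 2 := by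
    rw [Finset.sum_sub_distrib, Finset.sum_ite, Finset.sum_const_zero, add_zero, Finset.sum_const, nsmul_eq_mul,
      Finset.mul_sum]
    ring
  -- the far interior set is `I ∩ FamFar`
  have hFS : ((Ω.filter (fun i => (∀ k : Fin N, dist (x k) (x i) ≤ 8 → k ∈ Ω) ∧ (∀ (A : EuclideanSpace ℝ (Fin 3) →ₗᵢ[ℝ] EuclideanSpace ℝ (Fin 3)) (a h : ℝ), 47 / 50 ≤ a → a ≤ 1 → 39 / 50 * a ≤ h → h ≤ 17 / 20 * a → ∃ m u v : ℤ, ‖barlowPos 1 (Real.sqrt 6 / 3) (sW i) m u v‖ ≤ 3 ∧ r ≤ dist ((Gw i) (barlowPos 1 (Real.sqrt 6 / 3) (sW i) m u v)) (A (barlowPos a h (sW i) m u v))))).card : ℝ) =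
      ((I.filter (fun i => (∀ (A : EuclideanSpace ℝ (Fin 3) →ₗᵢ[ℝ] EuclideanSpace ℝ (Fin 3)) (a h : ℝ), 47 / 50 ≤ a → a ≤ 1 → 39 / 50 * a ≤ h → h ≤ 17 / 20 * a → ∃ m u v : ℤ, ‖barlowPos 1 (Real.sqrt 6 / 3) (sW i) m u v‖ ≤ 3 ∧ r ≤ dist ((Gw i) (barlowPos 1 (Real.sqrt 6 / 3) (sW i) m u v)) (A (barlowPos a h (sW i) m u v))))).card : ℝ) := by
    congr 2
    ext i
    simp only [Finset.mem_filter, hImem, and_assoc]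
  -- the collar count: `#B ≤ K · #∂₄Ω`
  have hcol := collar8_card_le x Ω
  have hpair := hCp N x hsep Ω hΩ (17 / 4) (by norm_num)
  rw [lc_natCard_eq] at hpair
  set B4c : ℝ := ((Ω.filter fun i => ∃ j : Fin N, j ∉ Ω ∧ dist (x j) (x i) ≤ 4).card : ℝ) with hB4c
  have hB40 : 0 ≤ B4c := Nat.cast_nonneg _
  have hBle : (B.card : ℝ) ≤ K * B4c := by
    have h1 : (B.card : ℝ) ≤ B4c + Cp * (17 / 4 : ℝ) ^ 4 * B4c := by
      have := hcol
      rw [← hBdef] at this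
      linarith
    have h2 : Cp * (17 / 4 : ℝ) ^ 4 * B4c ≤ |Cp| * (17 / 4 : ℝ) ^ 4 * B4c :=
      mul_le_mul_of_nonneg_right (mul_le_mul_of_nonneg_right (le_abs_self Cp) (by positivity)) hB40
    rw [hKdef]
    nlinarith
  have hRHS : (∑ i ∈ Ω, (1 / 2 : ℝ) * (∑ j ∈ Ω.erase i, lennardJones (dist (x i) (x j)))) -
      (Ω.card : ℝ) * (⨅ Q : PeriodicConfiguration 3, Q.energyPerParticle lennardJones) =
      ∑ i ∈ Ω, ((1 / 2 : ℝ) * (∑ j ∈ Ω.erase i, lennardJones (dist (x i) (x j))) - (⨅ Q : PeriodicConfiguration 3, Q.energyPerParticle lennardJones)) := by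
    rw [Finset.sum_sub_distrib, Finset.sum_const, nsmul_eq_mul]
  rw [hFS, hRHS]
  rw [hgsum] at key
  have hB0 : (0 : ℝ) ≤ (B.card : ℝ) := Nat.cast_nonneg _
  have hL0 : 0 ≤ L := by rw [hLdef]; positivity
  have hΦ0 : 0 ≤ Φc := by rw [hΦcdef]; positivity
  have hcoef : 0 ≤ L + Φc := by positivity
  have hstep : (L + Φc) * (B.card : ℝ) ≤ (L + Φc) * (K * B4c) := mul_le_mul_of_nonneg_left hBle hcoef
  nlinarith [key, hstep, hB0]

/-- **Stub piece `stub_famFarOpNorm`: far from the family on the template ⇒ far in operator norm (proved).**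
If a continuous linear map `T` realises the box-scaled isometric template on the sites of the unit template of
the word `s` (`T p₁ = A p_{a,h}` for every site), then an `r`-far witness site of norm `≤ 3`
(`r ≤ dist (G p₁) (A p_{a,h})`) gives `r ≤ 3·‖G − T‖`.  With `exists_clm_boxTemplate` this turns the crux's
far-from-family predicate `FamFar_r` into the operator-norm distance `≥ r/3` from `G` to every box-scaled
isometry, the input format of the Cauchy–Born landscape numerics. [folklore] -/
theorem stub_famFarOpNorm :
    ∀ (s : ℤ → ℤ) (G T : EuclideanSpace ℝ (Fin 3) →L[ℝ] EuclideanSpace ℝ (Fin 3))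
      (A : EuclideanSpace ℝ (Fin 3) →ₗᵢ[ℝ] EuclideanSpace ℝ (Fin 3)) (a h r : ℝ),
      (∀ m u v : ℤ, T (barlowPos 1 (Real.sqrt 6 / 3) s m u v) = A (barlowPos a h s m u v)) →
      (∃ m u v : ℤ, ‖barlowPos 1 (Real.sqrt 6 / 3) s m u v‖ ≤ 3 ∧
        r ≤ dist (G (barlowPos 1 (Real.sqrt 6 / 3) s m u v)) (A (barlowPos a h s m u v))) →
      r ≤ 3 * ‖G - T‖ := by
  intro s G T A a h r hT hfar
  obtain ⟨m, u, v, hn, hr⟩ := hfar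
  have hsub : (G - T) (barlowPos 1 (Real.sqrt 6 / 3) s m u v) =
      G (barlowPos 1 (Real.sqrt 6 / 3) s m u v) - A (barlowPos a h s m u v) := by
    rw [← hT]; rfl
  rw [dist_eq_norm, ← hsub] at hr
  calc r ≤ ‖(G - T) (barlowPos 1 (Real.sqrt 6 / 3) s m u v)‖ := hr
    _ ≤ ‖G - T‖ * ‖barlowPos 1 (Real.sqrt 6 / 3) s m u v‖ := (G - T).le_opNorm _
    _ ≤ ‖G - T‖ * 3 := mul_le_mul_of_nonneg_left hn (norm_nonneg _)
    _ = 3 * ‖G - T‖ := by ring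

/-- **The box-scaled isometric template is a linear image of the unit template.**  For a linear isometry
`A` and spacings `a, h` (unit template height `h₀ ≠ 0`), the continuous linear map
`T = A ∘ (a·id + (h/h₀ − a)·⟨e₃, ·⟩ e₃)` (isometry after the diagonal scaling `diag(a, a, h/h₀)`) sends every
unit site `barlowPos 1 h₀ s m u v` to `A (barlowPos a h s m u v)`, for every word `s`. [folklore] -/
theorem exists_clm_boxTemplate (A : EuclideanSpace ℝ (Fin 3) →ₗᵢ[ℝ] EuclideanSpace ℝ (Fin 3))
    (a h h₀ : ℝ) (hh₀ : h₀ ≠ 0) :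
    ∃ T : EuclideanSpace ℝ (Fin 3) →L[ℝ] EuclideanSpace ℝ (Fin 3),
      ∀ (s : ℤ → ℤ) (m u v : ℤ), T (barlowPos 1 h₀ s m u v) = A (barlowPos a h s m u v) := by
  let D : EuclideanSpace ℝ (Fin 3) →L[ℝ] EuclideanSpace ℝ (Fin 3) :=
    a • ContinuousLinearMap.id ℝ (EuclideanSpace ℝ (Fin 3)) +
      (h / h₀ - a) • (EuclideanSpace.proj (2 : Fin 3)).smulRight (EuclideanSpace.single (2 : Fin 3) (1 : ℝ))
  refine ⟨A.toContinuousLinearMap.comp D, fun s m u v => ?_⟩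
  have hD : D (barlowPos 1 h₀ s m u v) = barlowPos a h s m u v := by
    ext l
    fin_cases l
    · simp [D, barlowPos_apply_zero]
    · simp [D, barlowPos_apply_one]
      ring
    · simp [D, barlowPos_apply_two]
      field_simp
      ring
  rw [ContinuousLinearMap.comp_apply, hD]
  rfl

/-- **Stub piece `stub_boxTemplateRealizer` (proved).**  In the crux's vocabulary (unit template height `√6/3`):
for every linear isometry `A` and every cell `(a, h)` there is a continuous linear map `T` with
`T (barlowPos 1 (√6/3) s m u v) = A (barlowPos a h s m u v)` for every word `s` and every site — the map to feed
into `stub_famFarOpNorm`, so that `FamFar_r(i)` reads `‖G_i − A ∘ diag(a, a, h/(√6/3))‖ ≥ r/3` for all `A` and all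
box cells. [folklore] -/
theorem stub_boxTemplateRealizer :
    ∀ (A : EuclideanSpace ℝ (Fin 3) →ₗᵢ[ℝ] EuclideanSpace ℝ (Fin 3)) (a h : ℝ),
      ∃ T : EuclideanSpace ℝ (Fin 3) →L[ℝ] EuclideanSpace ℝ (Fin 3),
        ∀ (s : ℤ → ℤ) (m u v : ℤ), T (barlowPos 1 (Real.sqrt 6 / 3) s m u v) = A (barlowPos a h s m u v) :=
  fun A a h => exists_clm_boxTemplate A a h (Real.sqrt 6 / 3) (by positivity)

open Summit.AtomisticToContinuum.Crystallization.Theorems.BraggSlacknessRigidityStrictCertificate in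
/-- **Stub piece `stub_ljPairTaylor`: first-order Taylor bound for one Lennard-Jones bond (proved).**  For a bond
vector `v ≠ 0` and a perturbation `u` with `‖u‖ ≤ ‖v‖/4`,
`|V(‖v + u‖) − V(‖v‖) − (−‖v‖⁻¹⁴ + ‖v‖⁻⁸)·⟪v, u⟫| ≤ ‖u‖²·(7281 ‖v‖⁻¹⁴ + 521 ‖v‖⁻⁸)`, where
`(−‖v‖⁻¹⁴ + ‖v‖⁻⁸)·⟪v, u⟫ = V′(‖v‖)⟪v/‖v‖, u⟫` is the first variation (`V′(r)/r = −r⁻¹⁴ + r⁻⁸`).  Summed over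
the bonds of a site this is the remainder `|R_i| ≤ C_R ν_i²` of the sitewise Cauchy–Born expansion
`e_i = e_CB(G_i) + Lin_i + R_i` with an `r⁻⁸`-summable constant.  Proof: `V(r) = Ṽ(r²)`,
`‖v + u‖² = s + A + B` (`s = ‖v‖²`, `A = 2⟪v,u⟫`, `B = ‖u‖²`), the landed second-order Taylor bound for `Ṽ` on
`[s/2, ∞)`, `A² ≤ 4 s B`, `B ≤ s/16`. [folklore] -/
theorem stub_ljPairTaylor :
    ∀ (v u : EuclideanSpace ℝ (Fin 3)), v ≠ 0 → ‖u‖ ≤ ‖v‖ / 4 →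
      |lennardJones ‖v + u‖ - lennardJones ‖v‖ - (-((‖v‖ ^ 2)⁻¹) ^ 7 + ((‖v‖ ^ 2)⁻¹) ^ 4) * inner ℝ v u| ≤
        ‖u‖ ^ 2 * (7281 * ((‖v‖ ^ 2)⁻¹) ^ 7 + 521 * ((‖v‖ ^ 2)⁻¹) ^ 4) := by
  intro v u hv hu
  set s : ℝ := ‖v‖ ^ 2 with hsdef
  set B : ℝ := ‖u‖ ^ 2 with hBdef
  set A : ℝ := 2 * inner ℝ v u with hAdef
  have hvpos : 0 < ‖v‖ := norm_pos_iff.2 hv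
  have hs : 0 < s := by rw [hsdef]; positivity
  have hB0 : 0 ≤ B := by rw [hBdef]; positivity
  have hu0 : 0 ≤ ‖u‖ := norm_nonneg u
  -- squared norm of the perturbed bond
  have htp : ‖v + u‖ ^ 2 = s + A + B := by rw [hsdef, hAdef, hBdef, norm_add_sq_real]
  -- the Cauchy–Schwarz facts
  have hinner : |inner ℝ v u| ≤ ‖v‖ * ‖u‖ := abs_real_inner_le_norm v u
  have hvu : ‖v‖ * ‖u‖ ≤ s / 4 := by
    rw [hsdef]
    nlinarith [mul_le_mul_of_nonneg_left hu hvpos.le]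
  have hA : |A| ≤ s / 2 := by
    rw [hAdef, abs_mul, abs_two]
    linarith
  have hA2 : A ^ 2 ≤ 4 * s * B := by
    have h1 : inner ℝ v u ^ 2 ≤ (‖v‖ * ‖u‖) ^ 2 := by
      rw [← sq_abs]
      exact pow_le_pow_left₀ (abs_nonneg _) hinner 2
    rw [hAdef, hsdef, hBdef]
    nlinarith [h1]
  have hB : B ≤ s / 16 := by
    rw [hBdef, hsdef]
    nlinarith [mul_le_mul hu hu hu0 (by positivity : (0 : ℝ) ≤ ‖v‖ / 4)]
  -- the argument stays above `s/2`
  have hm : 0 < s / 2 := by linarith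
  have hss : s / 2 ≤ s := by linarith
  have htp' : s / 2 ≤ s + A + B := by have := neg_abs_le A; linarith [abs_nonneg A]
  -- `V = Ṽ ∘ sq`, and the inner product through `A`
  have hinnerA : inner ℝ v u = A / 2 := by rw [hAdef]; ring
  rw [lennardJones_eq_tildeV_sq ‖v + u‖, lennardJones_eq_tildeV_sq ‖v‖, htp, ← hsdef, hinnerA]
  -- the Taylor bound, with `(s/2)⁻¹ = 2 s⁻¹`
  have hp := abs_tildeV_taylor_le hm hss htp'
  have hd := abs_tildeV_deriv_le hs
  have hXs : s⁻¹ * s = 1 := inv_mul_cancel₀ hs.ne'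
  have hX0 : 0 < s⁻¹ := inv_pos.2 hs
  rw [show (s / 2)⁻¹ = 2 * s⁻¹ by rw [inv_div, div_eq_mul_inv]] at hp
  have e1 : s + A + B - s = A + B := by ring
  rw [e1] at hp
  -- make the atoms opaque
  clear_value s A B
  generalize hX : s⁻¹ = X at hp hd hXs hX0 ⊢
  set L : ℝ := (7 / 2) * (2 * X) ^ 8 + 2 * (2 * X) ^ 5 with hLdef
  set d : ℝ := -(1 / 2) * X ^ 7 + (1 / 2) * X ^ 4 with hddef
  have hL : L = 896 * X ^ 8 + 64 * X ^ 5 := by rw [hLdef]; ring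
  have hL0 : 0 ≤ L := by rw [hL]; positivity
  -- powers of `X` against `s`
  have hX8 : X ^ 8 * s = X ^ 7 := by
    calc X ^ 8 * s = X ^ 7 * (X * s) := by ring
      _ = X ^ 7 := by rw [hXs, mul_one]
  have hX5 : X ^ 5 * s = X ^ 4 := by
    calc X ^ 5 * s = X ^ 4 * (X * s) := by ring
      _ = X ^ 4 := by rw [hXs, mul_one]
  -- the quadratic term
  have hquad : L * (A + B) ^ 2 ≤ (7280 * X ^ 7 + 520 * X ^ 4) * B := by
    have h1 : (A + B) ^ 2 ≤ (65 / 8) * s * B := by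
      have h2 : B * B ≤ B * (s / 16) := mul_le_mul_of_nonneg_left hB hB0
      nlinarith [hA2, h2]
    have h3 := mul_le_mul_of_nonneg_left h1 hL0
    have hfin : L * ((65 / 8) * s * B) = (7280 * X ^ 7 + 520 * X ^ 4) * B := by
      rw [hL]
      have h4 : (896 * X ^ 8 + 64 * X ^ 5) * ((65 / 8) * s * B)
          = (65 / 8) * (896 * (X ^ 8 * s) + 64 * (X ^ 5 * s)) * B := by ring
      rw [h4, hX8, hX5]
      ring
    linarith
  -- the linear term `d · B`
  have hlin : |d * B| ≤ (1 / 2) * (X ^ 7 + X ^ 4) * B := by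
    rw [abs_mul, abs_of_nonneg hB0]
    exact mul_le_mul_of_nonneg_right hd hB0
  have hXB : 0 ≤ (X ^ 7 + X ^ 4) * B := by positivity
  -- the first variation is `d · A`
  have hdA : (-X ^ 7 + X ^ 4) * (A / 2) = d * (A + B) - d * B := by rw [hddef]; ring
  obtain ⟨hp1, hp2⟩ := abs_le.1 hp
  obtain ⟨hl1, hl2⟩ := abs_le.1 hlin
  rw [abs_le]
  constructor <;> linarith

end Summit.AtomisticToContinuum.Crystallization.Theorems.NashClassCertificatesNashNearField

end
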